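import Summits.QuantumFields.YangMills.Theorems.UnitScaleTiltHalvingP1FlatCoreFrameLinBCH
import Summits.QuantumFields.YangMills.Theorems.UnitScaleTiltProp8ChartDoubleBarAccumulated
import Literature.MathematicalPhysics.QuantumFieldTheory.Balaban1983to89.BlockAveragingEMLLinearised
import HarnessLib

/-!
# Route `UnitScaleTilt`, crux K1 child «MinimiserStabilityRegPr» (stmt-QuantumFields-19200), stub V2′ `stub_halvingStep` — pillar P1♭, brick **J4a (lattice half)**
# of the LEAD plan `T2FLAT-PLAN-v1.1-addendum-w5g4.md` (19200 evidence #46): **THE LOGARITHM OF THE FRAME-CORRECTED CENTRE VALUE OF A GAUGE COPY IS THE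
# BLOCK SITE-AVERAGE OF THE GAUGE PARAMETER UP TO A SMALL-LIPSCHITZ REMAINDER** ([Balaban1985Averaging] (110) p.34 frames; [Balaban1985RegularSpaces]
# Sect. E p.95; [Balaban1987RG1] (0.3)–(0.8) pp.252–253)

Cell `ym3-torus` (HUMAN RULING D-0037: YM₃ on T³ is ladder rung R3, not the Clay problem), LEAD seat `ym-ust-19200-w5` gen 4.
`--supports stmt-QuantumFields-19200 --as helper`; def-free, 0 sorry, standard axioms.  Nothing here claims the stub, the crux or the gap.

WHY (plan v1.1 F-d ∕ J4).  By ✓`Prop8ChartDoubleBar.dbarIterU_gaugeActT_eq` the double-bar tower of a gauge copy `U^{g}` is `(Ū^{(j)}U)^{ḡ_j}` with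
`ḡ_j(y) = V_j(U^g)(y)⁻¹·g(emb^j y)`, and by the frame recursion `ḡ_{j+1}(y) = v(U̿^{(j)}(U^g))(y)⁻¹ · ḡ_j(emb y)` where `U̿^{(j)}(U^g) = (U̿^{(j)}U)^{ḡ_j}`.
So the ONE-LEVEL letter of the top normalisation (o) is the map `g ↦ v(W^{g})(y)⁻¹ · g(emb y)` for a level-`j` field `W` and a level-`j` gauge map `g = exp ∘ l`.
THIS FILE: with `a := l(emb y)`, `b_i := l(x_i)` (`x_i` the end of the `i`-th centre stair of the block of `y`), `Z_i := log W(Γ_{y,x_i})`, that map is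
EXACTLY `exp` of the three-level BCH expression `F(a,b)` of ✓`P1FlatCoreFrameLinBCH` (`eml = exp ∘ mean ∘ log`, ✓`holT_gaugeActT`), hence (✓`threeLevelBCH_sub_mean_le`∕
`_lipschitz`): `log(v(W^{g})(y)⁻¹·g(emb y)) = log(v(W)(y)⁻¹) + (block SITE-AVERAGE of l) + Θ`, `‖Θ‖ ≤ 100(2δ+2ℓ)ℓ`, `Θ` `100(2δ+2ℓ)`-Lipschitz in `l` (sup over the
block's sites and centre) — the centre value `l(emb y)` has NO first-order effect, and the mean over the stair index family `Idx P` IS `LatticeFieldCalculus.siteAvg`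
(§3).  This is the letter the top-level Prop. 5 step with (o) (plan J4b∕J4c) linearises.

WHAT IS PROVED (generic complete normed `ℂ`-algebra `𝔸`, any `P : Params`, level `j`):
* §1 `coe_vframeU_eq_exp_meanCLM` (`v(W)(y) = exp(mean_i log W(Γ_{y,x_i}))`, no smallness),
  `coe_holT_stair_gaugeActT_eq_exp_bchLog` (each transformed stair transporter is `exp (bchLog a (bchLog Z_i (−b_i)))`), `coe_vframeU_gaugeActT_eq_exp`.
* §2 ★ `mlog_inv_vframeU_gaugeActT_mul_eq` (the (o)-letter IS `F(a,b)`), `mlog_inv_vframeU_eq` (`= −mean Z`), ★★ `norm_mlog_gbarStep_sub_mean_le`,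
  ★★ `norm_mlog_gbarStep_sub_mean_lipschitz`.
* §3 `meanCLM_stairEnd_eq_siteAvg` — the mean over `Idx P` of `l` at the stair ends is `siteAvg l y` ([B5] (1.8) block average; ✓`walkEnd_emb_stairWord_eq_blockSite`,
  ✓`sum_idx_of_fst`, ✓`card_idx`).
HONEST SCOPE: one level (the `k`-fold recursion through `dbarIterU` is the sibling `…CoreFrameLinTower`); smallness regime `2δ + 2ℓ ≤ 1/100` with `‖W(Γ_{y,x_i}) − 1‖ ≤ δ`,
`‖l‖ ≤ ℓ` at the centre and the stair ends; constants not optimised.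

References: T. Bałaban, CMP **98** (1985) 17–51 [Balaban1985Averaging] ((8)–(11) p.19, (110) p.34); CMP **99** (1985) 75–102 [Balaban1985RegularSpaces] (Sect. E p.95);
CMP **109** (1987) 249–301 [Balaban1987RG1] ((0.3)–(0.8) pp.252–253); CMP **95** (1984) 17–40 [Balaban1984PropagatorsI] ((1.8) p.19).
-/

set_option autoImplicit false

noncomputable section

namespace Summit.QuantumFields.YangMills.Theorems.P1FlatCoreFrameLin

open NormedSpace
open Literature.MathematicalPhysics.QuantumFieldTheory.Balaban1983to89
open T4Continuum BlockAveraging ExpMeanLog MatrixLog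
open B10Eq27TorusAxialLog (holT gaugeActT gaugeActT_apply)
open B7TransferAnalyticMean (meanCLM meanCLM_apply norm_meanCLM_apply_le)
open B12Membership313II (bchLog exp_bchLog norm_bchRem_le norm_expMul_sub_one_lt_one)
open BlockAveragingEMLAnalyticMean (eml_eq_exp_meanCLM)
open BlockAveragingEMLLinearised (walkEnd_emb_stairWord_eq_blockSite sum_idx_of_fst card_idx)
open Summit.QuantumFields.YangMills.Theorems.Prop8Chart (holT_gaugeActT)
open Summit.QuantumFields.YangMills.Theorems.Prop8ChartDoubleBar (vframeU coe_vframeU)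
open Summit.QuantumFields.YangMills.Theorems.P1FlatCoreFrameLinBCH (meanCLM_const norm_meanCLM_le_of_forall_le bchLog_zero_right exp_threeLevelBCH
  threeLevelBCH_sub_mean_le threeLevelBCH_sub_mean_lipschitz)

variable {P : Params} {j : ℕ} {𝔸 : Type*} [NormedRing 𝔸] [NormedAlgebra ℂ 𝔸] [CompleteSpace 𝔸]

/-! ## §1 Exponential forms of the frame and of the transformed stair transporters -/

section ExpForms

/-- **THE FRAME AS AN EXPONENTIAL** (no smallness): `v(W)(y) = exp(mean_i log W(Γ_{y,x_i}))`, `eml = exp ∘ mean ∘ log`. [cite: Balaban1985Averaging, (110) p.34; Balaban1987RG1, (0.4) p.253] -/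
theorem coe_vframeU_eq_exp_meanCLM (W : GaugeField P j 𝔸ˣ) (y : Site P (j + 1)) :
    ((vframeU W y : 𝔸ˣ) : 𝔸) = exp (meanCLM (Idx P) 𝔸 fun i : Idx P => mlog ((holT W (emb y) (stairWord i.2.1 (off i.1)) : 𝔸ˣ) : 𝔸)) := by
  rw [coe_vframeU, eml_eq_exp_meanCLM]

/-- **A TRANSFORMED STAIR TRANSPORTER IS A THREE-FACTOR EXPONENTIAL**: for `g = exp ∘ l`, `‖W(Γ_{y,x_i}) − 1‖ ≤ δ`, `‖l(emb y)‖, ‖l(x_i)‖ ≤ ℓ`, `2δ + 2ℓ ≤ 1/100`: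
`W^{g}(Γ_{y,x_i}) = g(emb y)·W(Γ)·g(x_i)⁻¹ = exp (bchLog (l (emb y)) (bchLog (log W(Γ)) (−l(x_i))))` (✓`holT_gaugeActT`, ✓`exp_mlog`, ✓`exp_bchLog`).
[cite: Balaban1985Averaging, (8)-(9) pp.18-19, (110) p.34] -/
theorem coe_holT_stair_gaugeActT_eq_exp_bchLog (W : GaugeField P j 𝔸ˣ) (g : GaugeTransf P j 𝔸ˣ) (l : Site P j → 𝔸)
    (hg : ∀ x, (g x : 𝔸) = exp (l x)) (y : Site P (j + 1)) (i : Idx P) {δ ℓ : ℝ} (hδ : 0 ≤ δ)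
    (hH : ‖((holT W (emb y) (stairWord i.2.1 (off i.1)) : 𝔸ˣ) : 𝔸) - 1‖ ≤ δ)
    (ha : ‖l (emb y)‖ ≤ ℓ) (hb : ‖l (walkEnd (emb y) (stairWord i.2.1 (off i.1)))‖ ≤ ℓ) (hs : 2 * δ + 2 * ℓ ≤ 1 / 100) :
    ((holT (gaugeActT g W) (emb y) (stairWord i.2.1 (off i.1)) : 𝔸ˣ) : 𝔸) =
      exp (bchLog (l (emb y)) (bchLog (mlog ((holT W (emb y) (stairWord i.2.1 (off i.1)) : 𝔸ˣ) : 𝔸))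
        (-(l (walkEnd (emb y) (stairWord i.2.1 (off i.1))))))) := by
  have hℓ : 0 ≤ ℓ := (norm_nonneg _).trans ha
  set H : 𝔸 := ((holT W (emb y) (stairWord i.2.1 (off i.1)) : 𝔸ˣ) : 𝔸) with hHdef
  set a : 𝔸 := l (emb y)
  set b : 𝔸 := l (walkEnd (emb y) (stairWord i.2.1 (off i.1)))
  -- `H = exp (log H)`, `‖log H‖ ≤ 2δ`
  have hH1 : ‖H - 1‖ ≤ 1 / 2 := hH.trans (by linarith)
  have hZ : ‖mlog H‖ ≤ 2 * δ := (norm_mlog_le_two_mul hH1).trans (by linarith)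
  have hexpZ : exp (mlog H) = H := exp_mlog (hH1.trans_lt (by norm_num))
  have hnb : ‖-b‖ ≤ ℓ := by rw [norm_neg]; exact hb
  -- the three factors
  rw [holT_gaugeActT, Units.val_mul, Units.val_mul, hg, B7Prop1Explicit.units_val_inv_eq_exp_neg (hg _), ← hHdef]
  rw [show exp a * H * exp (-b) = exp a * (exp (mlog H) * exp (-b)) by rw [hexpZ, mul_assoc]]
  -- inner BCH
  have h1 : ‖mlog H‖ + ‖-b‖ ≤ 1 / 4 := by linarith
  rw [← exp_bchLog (norm_expMul_sub_one_lt_one h1)]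
  -- outer BCH
  have hY : ‖bchLog (mlog H) (-b)‖ ≤ 2 * (2 * δ + 2 * ℓ) := by
    have h8 : ‖mlog H‖ + ‖-b‖ ≤ 1 / 8 := by linarith
    have hrem := norm_bchRem_le h8
    have hle : ‖mlog H‖ + ‖-b‖ ≤ 2 * δ + 2 * ℓ := by linarith
    have h0 : 0 ≤ ‖mlog H‖ + ‖-b‖ := by positivity
    have hsq : 3 * (‖mlog H‖ + ‖-b‖) ^ 2 ≤ 2 * δ + 2 * ℓ := by nlinarith
    calc ‖bchLog (mlog H) (-b)‖ = ‖(bchLog (mlog H) (-b) - (mlog H + -b)) + (mlog H + -b)‖ := by rw [sub_add_cancel]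
      _ ≤ ‖bchLog (mlog H) (-b) - (mlog H + -b)‖ + ‖mlog H + -b‖ := norm_add_le _ _
      _ ≤ 3 * (‖mlog H‖ + ‖-b‖) ^ 2 + (‖mlog H‖ + ‖-b‖) := by gcongr; exact norm_add_le _ _
      _ ≤ 2 * (2 * δ + 2 * ℓ) := by linarith
  have h2 : ‖a‖ + ‖bchLog (mlog H) (-b)‖ ≤ 1 / 4 := by linarith
  rw [← exp_bchLog (norm_expMul_sub_one_lt_one h2)]

/-- **THE FRAME OF A GAUGE COPY AS AN EXPONENTIAL**: `v(W^{g})(y) = exp (mean_i bchLog a (bchLog Z_i (−b_i)))` in the smallness regime (every stair of the block).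
[cite: Balaban1985Averaging, (110) p.34; Balaban1987RG1, (0.4) p.253] -/
theorem coe_vframeU_gaugeActT_eq_exp (W : GaugeField P j 𝔸ˣ) (g : GaugeTransf P j 𝔸ˣ) (l : Site P j → 𝔸)
    (hg : ∀ x, (g x : 𝔸) = exp (l x)) (y : Site P (j + 1)) {δ ℓ : ℝ} (hδ : 0 ≤ δ)
    (hH : ∀ i : Idx P, ‖((holT W (emb y) (stairWord i.2.1 (off i.1)) : 𝔸ˣ) : 𝔸) - 1‖ ≤ δ)
    (ha : ‖l (emb y)‖ ≤ ℓ) (hb : ∀ i : Idx P, ‖l (walkEnd (emb y) (stairWord i.2.1 (off i.1)))‖ ≤ ℓ) (hs : 2 * δ + 2 * ℓ ≤ 1 / 100) :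
    ((vframeU (gaugeActT g W) y : 𝔸ˣ) : 𝔸) =
      exp (meanCLM (Idx P) 𝔸 fun i : Idx P => bchLog (l (emb y))
        (bchLog (mlog ((holT W (emb y) (stairWord i.2.1 (off i.1)) : 𝔸ˣ) : 𝔸)) (-(l (walkEnd (emb y) (stairWord i.2.1 (off i.1))))))) := by
  have hℓ : 0 ≤ ℓ := (norm_nonneg _).trans ha
  rw [coe_vframeU_eq_exp_meanCLM]
  congr 1; congr 1; funext i
  rw [coe_holT_stair_gaugeActT_eq_exp_bchLog W g l hg y i hδ (hH i) ha (hb i) hs]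
  -- `log (exp X) = X` for the small exponent
  apply B7BlockAvgLog.mlog_exp
  have hZ : ‖mlog ((holT W (emb y) (stairWord i.2.1 (off i.1)) : 𝔸ˣ) : 𝔸)‖ ≤ 2 * δ :=
    (norm_mlog_le_two_mul ((hH i).trans (by linarith))).trans (by linarith [hH i])
  have hY : ‖bchLog (mlog ((holT W (emb y) (stairWord i.2.1 (off i.1)) : 𝔸ˣ) : 𝔸)) (-(l (walkEnd (emb y) (stairWord i.2.1 (off i.1)))))‖ ≤
      2 * (2 * δ + 2 * ℓ) := by
    set Z := mlog ((holT W (emb y) (stairWord i.2.1 (off i.1)) : 𝔸ˣ) : 𝔸)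
    set b := l (walkEnd (emb y) (stairWord i.2.1 (off i.1)))
    have h8 : ‖Z‖ + ‖-b‖ ≤ 1 / 8 := by rw [norm_neg]; linarith [hb i]
    have hrem := norm_bchRem_le h8
    have hle : ‖Z‖ + ‖-b‖ ≤ 2 * δ + 2 * ℓ := by rw [norm_neg]; linarith [hb i]
    have h0 : 0 ≤ ‖Z‖ + ‖-b‖ := by positivity
    have hsq : 3 * (‖Z‖ + ‖-b‖) ^ 2 ≤ 2 * δ + 2 * ℓ := by nlinarith
    calc ‖bchLog Z (-b)‖ = ‖(bchLog Z (-b) - (Z + -b)) + (Z + -b)‖ := by rw [sub_add_cancel]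
      _ ≤ ‖bchLog Z (-b) - (Z + -b)‖ + ‖Z + -b‖ := norm_add_le _ _
      _ ≤ 3 * (‖Z‖ + ‖-b‖) ^ 2 + (‖Z‖ + ‖-b‖) := by gcongr; exact norm_add_le _ _
      _ ≤ 2 * (2 * δ + 2 * ℓ) := by linarith
  set Y := bchLog (mlog ((holT W (emb y) (stairWord i.2.1 (off i.1)) : 𝔸ˣ) : 𝔸)) (-(l (walkEnd (emb y) (stairWord i.2.1 (off i.1)))))
  have h8 : ‖l (emb y)‖ + ‖Y‖ ≤ 1 / 8 := by linarith
  have hrem := norm_bchRem_le h8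
  have h0 : 0 ≤ ‖l (emb y)‖ + ‖Y‖ := by positivity
  have hsq : 3 * (‖l (emb y)‖ + ‖Y‖) ^ 2 ≤ 1 / 8 := by nlinarith
  have hlog2 : (1 : ℝ) / 2 < Real.log 2 := by linarith [Real.log_two_gt_d9]
  calc ‖bchLog (l (emb y)) Y‖ = ‖(bchLog (l (emb y)) Y - (l (emb y) + Y)) + (l (emb y) + Y)‖ := by rw [sub_add_cancel]
    _ ≤ ‖bchLog (l (emb y)) Y - (l (emb y) + Y)‖ + ‖l (emb y) + Y‖ := norm_add_le _ _
    _ ≤ 3 * (‖l (emb y)‖ + ‖Y‖) ^ 2 + (‖l (emb y)‖ + ‖Y‖) := by gcongr; exact norm_add_le _ _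
    _ < Real.log 2 := by linarith

end ExpForms

/-! ## §2 The one-level letter of (o): `log(v(W^{g})(y)⁻¹·g(emb y))` -/

section Main

/-- **★ THE (o)-LETTER IS THE THREE-LEVEL BCH MAP**: `log(v(W^{g})(y)⁻¹·g(emb y)) = bchLog (−m) a`, `m = mean_i bchLog a (bchLog Z_i (−b_i))` — the `F(a,b)` of
✓`P1FlatCoreFrameLinBCH` (`v⁻¹ = exp(−m)`, `g(emb y) = exp a`). [cite: Balaban1985Averaging, (110) p.34, (92) p.31; Balaban1987RG1, (0.4) p.253] -/
theorem mlog_inv_vframeU_gaugeActT_mul_eq (W : GaugeField P j 𝔸ˣ) (g : GaugeTransf P j 𝔸ˣ) (l : Site P j → 𝔸)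
    (hg : ∀ x, (g x : 𝔸) = exp (l x)) (y : Site P (j + 1)) {δ ℓ : ℝ} (hδ : 0 ≤ δ)
    (hH : ∀ i : Idx P, ‖((holT W (emb y) (stairWord i.2.1 (off i.1)) : 𝔸ˣ) : 𝔸) - 1‖ ≤ δ)
    (ha : ‖l (emb y)‖ ≤ ℓ) (hb : ∀ i : Idx P, ‖l (walkEnd (emb y) (stairWord i.2.1 (off i.1)))‖ ≤ ℓ) (hs : 2 * δ + 2 * ℓ ≤ 1 / 100) :
    mlog ((((vframeU (gaugeActT g W) y)⁻¹ * g (emb y) : 𝔸ˣ) : 𝔸)) =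
      bchLog (-(meanCLM (Idx P) 𝔸 fun i : Idx P => bchLog (l (emb y))
        (bchLog (mlog ((holT W (emb y) (stairWord i.2.1 (off i.1)) : 𝔸ˣ) : 𝔸)) (-(l (walkEnd (emb y) (stairWord i.2.1 (off i.1)))))))) (l (emb y)) := by
  rw [Units.val_mul, B7Prop1Explicit.units_val_inv_eq_exp_neg (coe_vframeU_gaugeActT_eq_exp W g l hg y hδ hH ha hb hs), hg]
  rfl

/-- `log(v(W)(y)⁻¹) = −mean_i log W(Γ_{y,x_i})` (the untransformed frame; `‖mean‖ ≤ 2δ < ln 2`). [cite: Balaban1985Averaging, (110) p.34] -/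
theorem mlog_inv_vframeU_eq (W : GaugeField P j 𝔸ˣ) (y : Site P (j + 1)) {δ : ℝ} (hδ : 0 ≤ δ) (hδ1 : δ ≤ 1 / 4)
    (hH : ∀ i : Idx P, ‖((holT W (emb y) (stairWord i.2.1 (off i.1)) : 𝔸ˣ) : 𝔸) - 1‖ ≤ δ) :
    mlog ((((vframeU W y)⁻¹ : 𝔸ˣ) : 𝔸)) = -(meanCLM (Idx P) 𝔸 fun i : Idx P => mlog ((holT W (emb y) (stairWord i.2.1 (off i.1)) : 𝔸ˣ) : 𝔸)) := by
  rw [B7Prop1Explicit.units_val_inv_eq_exp_neg (coe_vframeU_eq_exp_meanCLM W y)]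
  apply B7BlockAvgLog.mlog_exp
  rw [norm_neg]
  have hZ : ∀ i : Idx P, ‖mlog ((holT W (emb y) (stairWord i.2.1 (off i.1)) : 𝔸ˣ) : 𝔸)‖ ≤ 2 * δ := fun i =>
    (norm_mlog_le_two_mul ((hH i).trans (by linarith))).trans (by linarith [hH i])
  exact (norm_meanCLM_le_of_forall_le _ (by positivity) hZ).trans_lt (by linarith [Real.log_two_gt_d9])

/-- **★★ THE (o)-LETTER IS THE MEAN OF THE GAUGE PARAMETER OVER THE BLOCK, UP TO SECOND ORDER**:
`‖log(v(W^{g})(y)⁻¹·g(emb y)) − (log(v(W)(y)⁻¹) + mean_i l(x_i))‖ ≤ 100(2δ + 2ℓ)·ℓ` — the centre value `l(emb y)` does not enter at first order.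
[cite: Balaban1985RegularSpaces, Sect. E p.95; Balaban1985Averaging, (110) p.34; Balaban1987RG1, (0.8) p.253] -/
theorem norm_mlog_gbarStep_sub_mean_le (W : GaugeField P j 𝔸ˣ) (g : GaugeTransf P j 𝔸ˣ) (l : Site P j → 𝔸)
    (hg : ∀ x, (g x : 𝔸) = exp (l x)) (y : Site P (j + 1)) {δ ℓ : ℝ} (hδ : 0 ≤ δ)
    (hH : ∀ i : Idx P, ‖((holT W (emb y) (stairWord i.2.1 (off i.1)) : 𝔸ˣ) : 𝔸) - 1‖ ≤ δ)
    (ha : ‖l (emb y)‖ ≤ ℓ) (hb : ∀ i : Idx P, ‖l (walkEnd (emb y) (stairWord i.2.1 (off i.1)))‖ ≤ ℓ) (hs : 2 * δ + 2 * ℓ ≤ 1 / 100) :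
    ‖mlog ((((vframeU (gaugeActT g W) y)⁻¹ * g (emb y) : 𝔸ˣ) : 𝔸)) -
        (mlog ((((vframeU W y)⁻¹ : 𝔸ˣ) : 𝔸)) + meanCLM (Idx P) 𝔸 fun i : Idx P => l (walkEnd (emb y) (stairWord i.2.1 (off i.1))))‖ ≤
      100 * (2 * δ + 2 * ℓ) * ℓ := by
  have hℓ : 0 ≤ ℓ := (norm_nonneg _).trans ha
  have hZ : ∀ i : Idx P, ‖mlog ((holT W (emb y) (stairWord i.2.1 (off i.1)) : 𝔸ˣ) : 𝔸)‖ ≤ 2 * δ := fun i =>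
    (norm_mlog_le_two_mul ((hH i).trans (by linarith))).trans (by linarith [hH i])
  rw [mlog_inv_vframeU_gaugeActT_mul_eq W g l hg y hδ hH ha hb hs, mlog_inv_vframeU_eq W y hδ (by linarith) hH]
  exact threeLevelBCH_sub_mean_le (fun i : Idx P => mlog ((holT W (emb y) (stairWord i.2.1 (off i.1)) : 𝔸ˣ) : 𝔸)) (l (emb y))
    (fun i : Idx P => l (walkEnd (emb y) (stairWord i.2.1 (off i.1)))) (by positivity) hℓ hZ ha hb hs

/-- **★★ LIPSCHITZ FORM**: for two gauge maps `g₁ = exp ∘ l₁`, `g₂ = exp ∘ l₂` in the regime, the deviations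
`Θ(l) := log(v(W^{g})(y)⁻¹·g(emb y)) − log(v(W)(y)⁻¹) − mean_i l(x_i)` satisfy `‖Θ(l₁) − Θ(l₂)‖ ≤ 100(2δ + 2ℓ)·D` whenever `‖l₁ − l₂‖ ≤ D` at the centre and at the
stair ends — the contraction letter of the top-level Prop. 5 step with (o). [cite: Balaban1985RegularSpaces, Sect. E p.95, Prop. 5 p.94] -/
theorem norm_mlog_gbarStep_sub_mean_lipschitz (W : GaugeField P j 𝔸ˣ) (g₁ g₂ : GaugeTransf P j 𝔸ˣ) (l₁ l₂ : Site P j → 𝔸)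
    (hg₁ : ∀ x, (g₁ x : 𝔸) = exp (l₁ x)) (hg₂ : ∀ x, (g₂ x : 𝔸) = exp (l₂ x)) (y : Site P (j + 1)) {δ ℓ D : ℝ} (hδ : 0 ≤ δ) (hD : 0 ≤ D)
    (hH : ∀ i : Idx P, ‖((holT W (emb y) (stairWord i.2.1 (off i.1)) : 𝔸ˣ) : 𝔸) - 1‖ ≤ δ)
    (ha₁ : ‖l₁ (emb y)‖ ≤ ℓ) (hb₁ : ∀ i : Idx P, ‖l₁ (walkEnd (emb y) (stairWord i.2.1 (off i.1)))‖ ≤ ℓ)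
    (ha₂ : ‖l₂ (emb y)‖ ≤ ℓ) (hb₂ : ∀ i : Idx P, ‖l₂ (walkEnd (emb y) (stairWord i.2.1 (off i.1)))‖ ≤ ℓ) (hs : 2 * δ + 2 * ℓ ≤ 1 / 100)
    (hda : ‖l₁ (emb y) - l₂ (emb y)‖ ≤ D)
    (hdb : ∀ i : Idx P, ‖l₁ (walkEnd (emb y) (stairWord i.2.1 (off i.1))) - l₂ (walkEnd (emb y) (stairWord i.2.1 (off i.1)))‖ ≤ D) :
    ‖(mlog ((((vframeU (gaugeActT g₁ W) y)⁻¹ * g₁ (emb y) : 𝔸ˣ) : 𝔸)) -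
          (mlog ((((vframeU W y)⁻¹ : 𝔸ˣ) : 𝔸)) + meanCLM (Idx P) 𝔸 fun i : Idx P => l₁ (walkEnd (emb y) (stairWord i.2.1 (off i.1))))) -
        (mlog ((((vframeU (gaugeActT g₂ W) y)⁻¹ * g₂ (emb y) : 𝔸ˣ) : 𝔸)) -
          (mlog ((((vframeU W y)⁻¹ : 𝔸ˣ) : 𝔸)) + meanCLM (Idx P) 𝔸 fun i : Idx P => l₂ (walkEnd (emb y) (stairWord i.2.1 (off i.1)))))‖ ≤
      100 * (2 * δ + 2 * ℓ) * D := by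
  have hℓ : 0 ≤ ℓ := (norm_nonneg _).trans ha₁
  have hZ : ∀ i : Idx P, ‖mlog ((holT W (emb y) (stairWord i.2.1 (off i.1)) : 𝔸ˣ) : 𝔸)‖ ≤ 2 * δ := fun i =>
    (norm_mlog_le_two_mul ((hH i).trans (by linarith))).trans (by linarith [hH i])
  rw [mlog_inv_vframeU_gaugeActT_mul_eq W g₁ l₁ hg₁ y hδ hH ha₁ hb₁ hs, mlog_inv_vframeU_gaugeActT_mul_eq W g₂ l₂ hg₂ y hδ hH ha₂ hb₂ hs,
    mlog_inv_vframeU_eq W y hδ (by linarith) hH]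
  exact threeLevelBCH_sub_mean_lipschitz (fun i : Idx P => mlog ((holT W (emb y) (stairWord i.2.1 (off i.1)) : 𝔸ˣ) : 𝔸)) (l₁ (emb y)) (l₂ (emb y))
    (fun i : Idx P => l₁ (walkEnd (emb y) (stairWord i.2.1 (off i.1)))) (fun i : Idx P => l₂ (walkEnd (emb y) (stairWord i.2.1 (off i.1))))
    (by positivity) hℓ hD hZ ha₁ ha₂ hb₁ hb₂ hs hda hdb

end Main

/-! ## §3 The mean over the stair family is the block site-average -/

section SiteAvg

open LatticeFieldCalculus (siteAvg)

omit [CompleteSpace 𝔸] in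
/-- **THE MEAN OVER `Idx P` OF A SITE FUNCTION AT THE STAIR ENDS IS ITS BLOCK SITE-AVERAGE**: the stairs of `G(y,x)` end at the block sites
`Site.blockSite y r` (✓`walkEnd_emb_stairWord_eq_blockSite`), each offset `r` carried by `|S_d|²` orderings (✓`sum_idx_of_fst`, ✓`card_idx`), so the uniform mean is
`L^{−d}·Σ_r l(blockSite y r) = siteAvg l y` — the linear part of the (o)-letter is EXACTLY print's site-averaging `Q′`. [cite: Balaban1984PropagatorsI, (1.8) p.19; Balaban1987RG1, (0.3) p.252] -/
theorem meanCLM_stairEnd_eq_siteAvg (l : Site P j → 𝔸) (y : Site P (j + 1)) :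
    (meanCLM (Idx P) 𝔸 fun i : Idx P => l (walkEnd (emb y) (stairWord i.2.1 (off i.1)))) = siteAvg l y := by
  rw [meanCLM_apply]
  have hfun : (fun i : Idx P => l (walkEnd (emb y) (stairWord i.2.1 (off i.1)))) = fun i : Idx P => l (Site.blockSite y i.1) := by
    funext i; rw [walkEnd_emb_stairWord_eq_blockSite]
  rw [hfun, sum_idx_of_fst (fun r => l (Site.blockSite y r)), card_idx, siteAvg]
  set p : ℕ := Fintype.card (Equiv.Perm (Fin P.d))
  have hp : (p : ℂ) ≠ 0 := Nat.cast_ne_zero.2 Fintype.card_ne_zero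
  have hLd : ((P.L ^ P.d : ℕ) : ℂ) ≠ 0 := Nat.cast_ne_zero.2 (pow_ne_zero _ P.L_pos.ne')
  rw [← Nat.cast_smul_eq_nsmul ℂ, smul_smul, Nat.cast_mul, Nat.cast_pow p, mul_inv, mul_assoc, inv_mul_cancel₀ (pow_ne_zero _ hp), mul_one,
    ← Complex.coe_smul]
  congr 1
  push_cast
  rfl

end SiteAvg

end Summit.QuantumFields.YangMills.Theorems.P1FlatCoreFrameLin

end
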